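import Mathlib
import Summits.SmoothPoincare4.SmoothPoincare4.Theses.CongruenceShadows

/-!
# Sketch — crux-ideate stmt-SmoothPoincare4-14596 (HeegaardHandlebodyCongruenceClosed), ideator 3

First lemmas of the three idea cards, stated over existing declarations
(`Literature.Topology.FourManifolds.{SurfaceGroup, s4Kernels, TrisectionKernels.stabilizeIter}` and the
route decl `Summit.SmoothPoincare4.SmoothPoincare4.Theses.CongruenceShadows.HeegaardHandlebodyCongruenceClosed`).
Nothing here is a proof of the crux; `hhcc_iff` is the read-back check that the abbreviations below are
definitionally the crux.
-/

namespace Summit.SmoothPoincare4.SmoothPoincare4.Cruxes.HeegaardHandlebodyCongruenceClosed.Sketch3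

open Literature.Topology.FourManifolds

/-- `S m = S_{3+3m}`, the surface group at the route's genus. -/
abbrev S (m : ℕ) : Type := SurfaceGroup (3 + 3 * m)

/-- `N m i`, the `i`-th kernel of the `m`-fold stabilised standard `S⁴` triple. -/
abbrev N (m : ℕ) (i : Fin 3) : Subgroup (S m) := s4Kernels.stabilizeIter m i

/-- `x` stabilises `N m i` (as a set). -/
def Stab (m : ℕ) (i : Fin 3) (x : S m ≃* S m) : Prop := (N m i).map x.toMonoidHom = N m i

/-- `x ∈ H = A ∩ B` (Goeritz group of the standard pair `(N₀,N₁)`, inside `Aut S`). -/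
def InH (m : ℕ) (x : S m ≃* S m) : Prop := Stab m 0 x ∧ Stab m 1 x

/-- `c ∈ K = C` (handlebody group of `N₂`). -/
def InK (m : ℕ) (c : S m ≃* S m) : Prop := Stab m 2 c

/-- The crux hypothesis: `ρ` is congruent to an element of `(A∩B)·C` modulo every characteristic
finite-index `M` (strong = image form). -/
def Hyp (m : ℕ) (ρ : S m ≃* S m) : Prop :=
  ∀ M : Subgroup (S m), M.Characteristic → M.FiniteIndex →
    ∃ x c : S m ≃* S m, Stab m 0 x ∧ Stab m 1 x ∧ Stab m 2 c ∧ ∀ s, ρ s * (x (c s))⁻¹ ∈ M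

/-- The crux conclusion: `ρ ∈ (A∩B)·C`. -/
def Concl (m : ℕ) (ρ : S m ≃* S m) : Prop :=
  ∃ x c : S m ≃* S m, Stab m 0 x ∧ Stab m 1 x ∧ Stab m 2 c ∧ ∀ s, ρ s = x (c s)

/-- Read-back: the crux is literally `∀ m ρ, Hyp m ρ → Concl m ρ`. -/
theorem hhcc_iff :
    Summit.SmoothPoincare4.SmoothPoincare4.Theses.CongruenceShadows.HeegaardHandlebodyCongruenceClosed ↔
      ∀ (m : ℕ) (ρ : S m ≃* S m), Hyp m ρ → Concl m ρ :=
  Iff.rfl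

/-! ## Card `profinite-pair-rigidity` -/

/-- `ρ ∈ A·C`: the pair `(N₀, ρN₂)` is the image of the standard pair `(N₀,N₂)` under one automorphism. -/
def InAC (m : ℕ) (ρ : S m ≃* S m) : Prop :=
  ∃ a c : S m ≃* S m, Stab m 0 a ∧ Stab m 2 c ∧ ∀ s, ρ s = a (c s)

/-- `ρ ∈ B·C`. -/
def InBC (m : ℕ) (ρ : S m ≃* S m) : Prop :=
  ∃ b c : S m ≃* S m, Stab m 1 b ∧ Stab m 2 c ∧ ∀ s, ρ s = b (c s)

/-- FIRST LEMMA of card `profinite-pair-rigidity` ("profinite Waldhausen pairs"): a congruence-limit of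
products has both visible Heegaard pairs standard. Route of proof: finite quotients of
`S/⟪N₀ ∪ ρN₂⟫` are those of `F_{m+1}` ⇒ same profinite completion (Dixon–Formanek–Poland–Ribes) ⇒
`Y ≅ #^{m+1} S¹×S²` (Wilton–Zalesskii 2019 Thm 1 + Perelman) ⇒ the genus-`(3+3m)` splitting is
standard (Waldhausen) ⇒ Dehn–Nielsen–Baer. -/
def PairRigidity : Prop :=
  ∀ (m : ℕ) (ρ : S m ≃* S m), Hyp m ρ → InAC m ρ ∧ InBC m ρ

/-- The RELATIVE GATE on the congruence locus (transfer target `C⁺` of the card): for `ρ` already in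
`B ∩ A·C` (normal form) the crux conclusion holds. -/
def RelativeGate : Prop :=
  ∀ (m : ℕ) (ρ : S m ≃* S m), Hyp m ρ → Stab m 1 ρ → InAC m ρ → Concl m ρ

/-! ## Card `prym-tower-linearisation` -/

/-- FIRST LEMMA of card `prym-tower-linearisation` (Torelli-level closure, all `m`): modulo the
Torelli group the crux holds — `ρ ≡ x∘c` on `H₁(S) = S/[S,S]`. At `m = 0` this is the refuter's
`GSp₆(ℤ)` class-number-one computation; in general a `GSp_{6(m+1)}(ℤ)` statement about the pair of
parabolic-type stabilisers of the standard Lagrangian triple. -/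
def TorelliLevelClosure : Prop :=
  ∀ (m : ℕ) (ρ : S m ≃* S m), Hyp m ρ →
    ∃ x c : S m ≃* S m, Stab m 0 x ∧ Stab m 1 x ∧ Stab m 2 c ∧
      ∀ s, ρ s * (x (c s))⁻¹ ∈ commutator (S m)

/-- `ρ ≡ x∘c` modulo the level-`M` Torelli group `𝓘_M` (trivial on `S/M` and on `H₁(M) = M/[M,M]`). -/
def CongModTorelli (m : ℕ) (M : Subgroup (S m)) (ρ x c : S m ≃* S m) : Prop :=
  (∀ s, ρ s * (x (c s))⁻¹ ∈ M) ∧ (∀ s ∈ M, ρ s * (x (c s))⁻¹ ∈ ⁅M, M⁆)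

/-- ARITHMETIC HALF (Prym tower closure): at every characteristic level `M` the crux holds modulo
`𝓘_M` — i.e. after pushing into the arithmetic quotient `Aut_{S/M}(H₁(M;ℤ))` (Looijenga /
Grunewald–Larsen–Lubotzky–Malestein) the product of the images of `H` and `K` is congruence-closed. -/
def PrymTowerClosure : Prop :=
  ∀ (m : ℕ) (ρ : S m ≃* S m), Hyp m ρ →
    ∀ M : Subgroup (S m), M.Characteristic → M.FiniteIndex →
      ∃ x c : S m ≃* S m, Stab m 0 x ∧ Stab m 1 x ∧ Stab m 2 c ∧ CongModTorelli m M ρ x c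

/-- TOPOLOGICAL HALF (Torelli-tower intersection): `⋂_M (A∩B)·C·𝓘_M = (A∩B)·C`. -/
def TorelliTowerIntersection : Prop :=
  ∀ (m : ℕ) (ρ : S m ≃* S m),
    (∀ M : Subgroup (S m), M.Characteristic → M.FiniteIndex →
      ∃ x c : S m ≃* S m, Stab m 0 x ∧ Stab m 1 x ∧ Stab m 2 c ∧ CongModTorelli m M ρ x c) →
    Concl m ρ

/-- The card's composition is pure logic. -/
theorem hhcc_of_prym (h₁ : PrymTowerClosure) (h₂ : TorelliTowerIntersection) :
    Summit.SmoothPoincare4.SmoothPoincare4.Theses.CongruenceShadows.HeegaardHandlebodyCongruenceClosed :=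
  hhcc_iff.2 fun m ρ hρ => h₂ m ρ (h₁ m ρ hρ)

/-! ## Card `free-splitting-shadow` -/

/-- `t` acts trivially on `π₁(V₁) = S/N₁` (the Luft–McCullough twist subgroup of the handlebody group
of `N₁`, in `Aut S`). -/
def IsTwistLike (m : ℕ) (t : S m ≃* S m) : Prop := ∀ s, t s * s⁻¹ ∈ N m 1

/-- Kervaire exclusion: on the congruence locus the triple quotient is trivial
(`N₀ · N₁ · ρN₂ = S`, i.e. the trisected homology 4-sphere has `π₁ = 1`; automatic at `m = 0`). -/
def KervaireExclusion : Prop :=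
  ∀ (m : ℕ) (ρ : S m ≃* S m), Hyp m ρ → Stab m 1 ρ → InAC m ρ →
    N m 0 ⊔ N m 1 ⊔ (N m 2).map ρ.toMonoidHom = ⊤

/-- Nielsen connectivity for `F_k × F_k` at rank `3k` (weak form, post-composition allowed): any two
epimorphisms `F_{3k} ↠ F_k × F_k` differ by automorphisms of source and target. `k = 1`: Smith normal
form for primitive `2 × 3` integer matrices. Pure combinatorial group theory. -/
def NielsenConnectedFkFk : Prop :=
  ∀ (k : ℕ) (θ θ' : FreeGroup (Fin (3 * k)) →* FreeGroup (Fin k) × FreeGroup (Fin k)),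
    Function.Surjective θ → Function.Surjective θ' →
      ∃ (φ : FreeGroup (Fin (3 * k)) ≃* FreeGroup (Fin (3 * k)))
        (ψ : (FreeGroup (Fin k) × FreeGroup (Fin k)) ≃* (FreeGroup (Fin k) × FreeGroup (Fin k))),
        ∀ w, θ' w = ψ (θ (φ w))

/-- Goeritz surjectivity, quotient-free form ("homotopy-Goeritz = Goeritz ∘ twists"): an element of the
handlebody group of `V₁` that preserves the kernel `N₀N₁` of `π₁Σ → π₁(V₀ ∪ V₁)` is a Goeritz element
followed by a `V₁`-twist; and the same for the pair `(V₁, V₂)`. -/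
def GoeritzTimesTwists : Prop :=
  ∀ (m : ℕ) (φ : S m ≃* S m), Stab m 1 φ →
    ((N m 0 ⊔ N m 1).map φ.toMonoidHom = N m 0 ⊔ N m 1 →
      ∃ h t : S m ≃* S m, (Stab m 0 h ∧ Stab m 1 h) ∧ IsTwistLike m t ∧ ∀ s, φ s = h (t s)) ∧
    ((N m 1 ⊔ N m 2).map φ.toMonoidHom = N m 1 ⊔ N m 2 →
      ∃ j t : S m ≃* S m, (Stab m 1 j ∧ Stab m 2 j) ∧ IsTwistLike m t ∧ ∀ s, φ s = t (j s))

/-- FIRST LEMMA of card `free-splitting-shadow` (twist reduction): a normal-form `ρ` with trivial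
triple quotient factors as Goeritz(V₀,V₁) ∘ twist ∘ Goeritz(V₁,V₂) (twist in the MIDDLE, so that the
residual twist inherits `Hyp` and `InAC`, both left-`H`- and right-`K`-invariant). Route of proof:
project to `Aut(S/N₁) = Aut(F_{3k})`, where the triple becomes an epimorphism `F_{3k} ↠ F_k × F_k`;
`NielsenConnectedFkFk` puts `β(ρ)` into `Stab(L₀)·Stab(L₂′)`, `GoeritzTimesTwists` lifts. -/
def TwistReduction : Prop :=
  ∀ (m : ℕ) (ρ : S m ≃* S m), Stab m 1 ρ →
    N m 0 ⊔ N m 1 ⊔ (N m 2).map ρ.toMonoidHom = ⊤ →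
      ∃ h t j : S m ≃* S m, (Stab m 0 h ∧ Stab m 1 h) ∧ IsTwistLike m t ∧ (Stab m 1 j ∧ Stab m 2 j) ∧
        ∀ s, ρ s = h (t (j s))

/-- The residual crux on the Luft–McCullough twist subgroup of the handlebody group of `V₁`. -/
def TwistAbsorption : Prop :=
  ∀ (m : ℕ) (t : S m ≃* S m), Hyp m t → IsTwistLike m t → InAC m t → Concl m t

end Summit.SmoothPoincare4.SmoothPoincare4.Cruxes.HeegaardHandlebodyCongruenceClosed.Sketch3
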